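import Summits.CriticalPhenomena.PercolationContinuityZ3.Theorems.PercNearOneGluingNoHeavyLowerTailSunflowerMultiPetalKempeUnion
import HarnessLib
import HarnessLib.Audit

/-!
# `NoHeavyLowerTail` (crux stmt-CriticalPhenomena-4575), Lemma B for graph clutters: the ONE-POINT KERNEL, the PINNED one-point
# obligation, and its reduction to Lemma B for every finite graph

Support file (seat `prim-l12-p2` gen 41; `--supports stmt-CriticalPhenomena-4575`; companion of `…SunflowerMultiPetalKempeConnected`
(p409076: `MZQConnected`, `Qcol_nonneg_of_connected`) and `…SunflowerMultiPetalKempeUnion` (p409476: `ctype`, `lbW_ctype`,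
`Qcol_nonneg_of_MZQConnected'`)).  No `sorry`; nothing is asserted about the crux; the `@[conjecture]` definition is an obligation of the
programme, never a fact.  Memo: run/shared/lean/prim/prim-l12/prim-l12-p2/FINDING-g41-TWO-TERMINAL-REDUCTION.md §1–§2.

ONE-POINT DECOMPOSITION.  For a vertex `x`, colourings `σ : V → Fin 3` are pairs (`τ` = restriction to `V ∖ {x}`, colour `c` of `x`)
(`extCol`, `Qcol_eq_sum_extCol`), so `Q(G) − Q(G − x) = Σ_τ K(τ)` with the ONE-POINT KERNEL `K(τ) = Σ_c q_G(τ, x ↦ c) − q_{G−x}(τ)`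
(`kerMZ`, `Qcol_sub_Qcol_induce`).  The colour counts split as `X_c(σ) = X_c(σ|_{V∖x}) + [σ x = c]·#{w ∼ x : σ w = c}`
(`cnt_eq_cnt_induce_add`), hence the capped type of `(τ, c)` is the capped sum of the type of `τ` in `G − x` and `d_c(τ)·e_c`, with
`d(τ)` the colour PROFILE of the neighbourhood of `x` (`ctype_extCol`), and `K(τ) = kerAbs (type τ) (profile τ)` for an explicit function
`kerAbs : CType → CType → ℤ` (`kerMZ_eq_kerAbs`).  POINTWISE FACTS (finite checks): `kerAbs t d ≥ 0` whenever no colour is absent from the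
neighbourhood (`kerAbs_nonneg_of_ne_zero`) or two colours occur at least twice (`kerAbs_nonneg_of_two_two*`); for a constant boundary
(`d = (k,0,0)`) the kernel is `q(t ∨ 2e_a) + q(t)` resp. `q(t + e_a) + q(t)` (`kerAbs_const_two`, `kerAbs_const_one`) — Lemma-B weights of
the contracted graph `(G−x)/N(x)` with and without a double mark — and for a two-coloured boundary (`d = (k,1,0)`) it is the TWO-TERMINAL
weight `fC t = q(t+e_a) + q(t+e_b)` (`kerAbs_one_one`) resp. dominates it (`fC_le_kerAbs_two_one`).  These are the pointwise identities
behind the memo's reduction "Lemma B ⟸ the two-terminal inequality (C)".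

PINNED OBLIGATION.  `PinnedMZ` (OPEN; exact enumeration: 0 failures over every connected graph on ≤ 9 vertices, every vertex `x` with
`G − x` connected and EVERY colouring `κ` of `N(x)` — n ≤ 8 locally, n = 9 kit j246348 (74.9 M boundary classes); slack `P/M ≥ 2.03` in every
class with an absent colour): the kernel sum
over the colourings that agree with `κ` on `N(x)` is nonnegative (`pinnedClass`).  Summing over the classes (`sum_kerMZ_nonneg_of_classes`,
fibres of `nbKey`) gives `MZQConnected` (`mzqConnected_of_pinnedMZ`) and therefore, by p409476, Lemma B in colouring language for EVERY
finite graph (`Qcol_nonneg_of_pinnedMZ`).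
-/

namespace Summit.CriticalPhenomena.PercolationContinuityZ3.Theorems.SunflowerPartition.Kempe

open Finset
open scoped Classical

section Ext

variable {V : Type*} (x : V)

/-! ## Colourings of `V` as (colouring of `V ∖ {x}`, colour of `x`) -/

/-- Extend a colouring of `V ∖ {x}` by the colour `c` at `x`. [this work] -/
noncomputable def extCol (τ : (({x}ᶜ : Set V)) → Fin 3) (c : Fin 3) : V → Fin 3 :=
  fun v => if h : v = x then c else τ ⟨v, Set.mem_compl_singleton_iff.mpr h⟩

/-- `extCol` at `x`. [this work] -/
theorem extCol_self (τ : (({x}ᶜ : Set V)) → Fin 3) (c : Fin 3) : extCol x τ c x = c := by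
  unfold extCol; rw [dif_pos rfl]

/-- `extCol` away from `x`. [this work] -/
theorem extCol_of_ne (τ : (({x}ᶜ : Set V)) → Fin 3) (c : Fin 3) {v : V} (h : v ≠ x) :
    extCol x τ c v = τ ⟨v, Set.mem_compl_singleton_iff.mpr h⟩ := by
  unfold extCol; rw [dif_neg h]

/-- `extCol` restricted to `V ∖ {x}` is `τ`. [this work] -/
theorem extCol_val (τ : (({x}ᶜ : Set V)) → Fin 3) (c : Fin 3) (w : ({x}ᶜ : Set V)) : extCol x τ c w.1 = τ w := by
  rw [extCol_of_ne x τ c (Set.mem_compl_singleton_iff.mp w.2)]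

/-- `extCol ∘ val = τ`. [this work] -/
theorem extCol_comp_val (τ : (({x}ᶜ : Set V)) → Fin 3) (c : Fin 3) : extCol x τ c ∘ Subtype.val = τ :=
  funext (extCol_val x τ c)

/-- A colouring is the extension of its restriction by its value at `x`. [this work] -/
theorem extCol_restrict (σ : V → Fin 3) : extCol x (σ ∘ Subtype.val) (σ x) = σ := by
  funext v
  by_cases h : v = x
  · rw [h, extCol_self]
  · rw [extCol_of_ne x _ _ h]; rfl

end Ext

section OnePoint

variable {V : Type*} [Fintype V] (G : SimpleGraph V) (x : V)

/-- `Q(G)` as a double sum over the colourings of `V ∖ {x}` and the colour of `x`. [this work] -/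
theorem Qcol_eq_sum_extCol :
    Qcol G = ∑ τ : (({x}ᶜ : Set V)) → Fin 3, ∑ c : Fin 3, qcol G (extCol x τ c) := by
  unfold Qcol
  rw [← Fintype.sum_prod_type']
  refine sum_nbij' (fun σ => (σ ∘ Subtype.val, σ x)) (fun p => extCol x p.1 p.2) (by simp) (by simp)
    (fun σ _ => extCol_restrict x σ) (fun p _ => Prod.ext (extCol_comp_val x p.1 p.2) (extCol_self x p.1 p.2))
    (fun σ _ => ?_)
  dsimp only
  rw [extCol_restrict]

/-! ## The one-point kernel -/

/-- The ONE-POINT KERNEL `K(τ) = Σ_c q_G(τ, x ↦ c) − q_{G−x}(τ)`. [this work] -/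
noncomputable def kerMZ (τ : (({x}ᶜ : Set V)) → Fin 3) : ℤ :=
  (∑ c : Fin 3, qcol G (extCol x τ c)) - qcol (G.induce ({x}ᶜ : Set V)) τ

/-- `Q(G − x)` as a sum over the colourings of `V ∖ {x}` (fixing the instance path). [this work] -/
theorem Qcol_induce_eq_sum :
    Qcol (G.induce ({x}ᶜ : Set V)) = ∑ τ : (({x}ᶜ : Set V)) → Fin 3, qcol (G.induce ({x}ᶜ : Set V)) τ := by
  unfold Qcol
  exact sum_congr (Finset.ext fun τ => by simp only [mem_univ]) (fun _ _ => rfl)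

/-- `Q(G) − Q(G − x) = Σ_τ K(τ)`. [this work] -/
theorem Qcol_sub_Qcol_induce : Qcol G - Qcol (G.induce ({x}ᶜ : Set V)) = ∑ τ, kerMZ G x τ := by
  rw [Qcol_eq_sum_extCol G x, Qcol_induce_eq_sum G x]
  unfold kerMZ
  rw [sum_sub_distrib]

/-! ## Pinned classes -/

/-- The PINNED CLASS of `κ`: colourings of `V ∖ {x}` that agree with `κ` on the neighbourhood of `x`. [this work] -/
noncomputable def pinnedClass (κ : V → Fin 3) : Finset ((({x}ᶜ : Set V)) → Fin 3) :=
  univ.filter fun τ => ∀ w : ({x}ᶜ : Set V), G.Adj x w.1 → τ w = κ w.1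

/-- The key of a colouring: its values on `N(x)`, zero elsewhere (so that the fibres of the key are the pinned classes). [this work] -/
noncomputable def nbKey (τ : (({x}ᶜ : Set V)) → Fin 3) : V → Fin 3 :=
  fun w => if h : w ≠ x ∧ G.Adj x w then τ ⟨w, Set.mem_compl_singleton_iff.mpr h.1⟩ else 0

/-- A nonempty fibre of `nbKey` is the pinned class of its key. [this work] -/
theorem fiber_nbKey_eq (κ : V → Fin 3) (τ₀ : (({x}ᶜ : Set V)) → Fin 3) (h0 : nbKey G x τ₀ = κ) :
    (univ.filter fun τ => nbKey G x τ = κ) = pinnedClass G x κ := by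
  ext τ
  simp only [pinnedClass, mem_filter, mem_univ, true_and]
  constructor
  · intro h w hw
    have hwx : w.1 ≠ x := Set.mem_compl_singleton_iff.mp w.2
    have := congrFun h w.1
    unfold nbKey at this
    rw [dif_pos ⟨hwx, hw⟩] at this
    exact this
  · intro h
    funext w
    have h0w := congrFun h0 w
    unfold nbKey at h0w ⊢
    by_cases hw : w ≠ x ∧ G.Adj x w
    · rw [dif_pos hw]
      exact h ⟨w, Set.mem_compl_singleton_iff.mpr hw.1⟩ hw.2
    · rw [dif_neg hw] at h0w ⊢
      exact h0w

/-- **PINNED ONE-POINT MONOTONICITY** (this work; OPEN; exact enumeration: 0 failures over all connected graphs on ≤ 9 vertices, all `x`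
with `G − x` connected and all boundary colourings — n ≤ 8 locally, n = 9 kit j246348; boundary-class slack `P/M ≥ 2.03`): for a connected finite graph `G`, a
vertex `x` whose deletion leaves `G` connected, and any prescribed colouring `κ` of the neighbours of `x`, the one-point kernel summed
over the colourings of `V ∖ {x}` that agree with `κ` on `N(x)` is nonnegative.  An obligation, never a fact: use as `(h : PinnedMZ)`.
[status: open] -/
@[conjecture] def PinnedMZ : Prop :=
  ∀ (V : Type) [Fintype V] (G : SimpleGraph V) (x : V), G.Connected → (G.induce ({x}ᶜ : Set V)).Connected →
    ∀ κ : V → Fin 3, 0 ≤ ∑ τ ∈ pinnedClass G x κ, kerMZ G x τ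

/-- Summing the pinned classes: if every class sum is nonnegative, so is the whole kernel sum. [this work] -/
theorem sum_kerMZ_nonneg_of_classes (h : ∀ κ : V → Fin 3, 0 ≤ ∑ τ ∈ pinnedClass G x κ, kerMZ G x τ) :
    0 ≤ ∑ τ, kerMZ G x τ := by
  rw [← sum_fiberwise univ (nbKey G x) (kerMZ G x)]
  refine sum_nonneg fun κ _ => ?_
  by_cases hne : (univ.filter fun τ => nbKey G x τ = κ).Nonempty
  · obtain ⟨τ₀, hτ₀⟩ := hne
    rw [fiber_nbKey_eq G x κ τ₀ (mem_filter.1 hτ₀).2]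
    exact h κ
  · rw [not_nonempty_iff_eq_empty.1 hne, sum_empty]


/-! ## The colour profile of `N(x)` and the type decomposition -/

/-- `prof τ c`: the number of neighbours of `x` coloured `c` by `τ`. [this work] -/
noncomputable def prof (τ : (({x}ᶜ : Set V)) → Fin 3) (c : Fin 3) : ℕ :=
  (univ.filter fun w : ({x}ᶜ : Set V) => G.Adj x w.1 ∧ τ w = c).card

/-- The capped colour PROFILE `d(τ) = (d_0, d_1, d_2)` of the neighbourhood of `x`. [this work] -/
noncomputable def prof3 (τ : (({x}ᶜ : Set V)) → Fin 3) : CType := (cap3 (prof G x τ 0), cap3 (prof G x τ 1), cap3 (prof G x τ 2))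

omit [Fintype V] in
/-- An edge is not inside `V ∖ {x}` iff it contains `x`. [this work] -/
theorem not_inside_compl_iff (e : Sym2 V) : ¬Inside ({x}ᶜ : Set V) e ↔ x ∈ e := by
  unfold Inside
  constructor
  · intro h
    by_contra hx
    exact h fun v hv => Set.mem_compl_singleton_iff.mpr fun hvx => hx (hvx ▸ hv)
  · intro hx h
    exact Set.mem_compl_singleton_iff.mp (h x hx) rfl

/-- The monochromatic edges of colour `c` at `x` under `(τ, x ↦ c₀)`: none unless `c₀ = c`, and then one per neighbour of colour `c`.
[this work] -/
theorem card_monoCol_extCol_filter_mem (τ : (({x}ᶜ : Set V)) → Fin 3) (c₀ c : Fin 3) :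
    ((monoCol G (extCol x τ c₀) c).filter fun e => x ∈ e).card = if c₀ = c then prof G x τ c else 0 := by
  split_ifs with hc
  · unfold prof
    symm
    refine card_bij (fun w _ => s(x, w.1)) (fun w hw => ?_) (fun w₁ _ w₂ _ h => ?_) (fun e he => ?_)
    · simp only [mem_filter, mem_univ, true_and] at hw
      rw [mem_filter, mk_mem_monoCol_iff, extCol_self, extCol_val]
      exact ⟨⟨hw.1, hc, hw.2⟩, Sym2.mem_mk_left _ _⟩
    · exact Subtype.ext (Sym2.congr_right.1 h)
    · induction e using Sym2.ind with
      | _ p q =>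
        rw [mem_filter, mk_mem_monoCol_iff] at he
        obtain ⟨⟨hpq, hp, hq⟩, hxe⟩ := he
        rcases Sym2.mem_iff.1 hxe with hxp | hxq
        · have hqx : q ≠ x := fun h => G.ne_of_adj hpq (by rw [h, hxp])
          have hadj : G.Adj x q := by rw [hxp]; exact hpq
          refine ⟨⟨q, Set.mem_compl_singleton_iff.mpr hqx⟩, ?_, ?_⟩
          · simp only [mem_filter, mem_univ, true_and]
            refine ⟨hadj, ?_⟩
            rw [← extCol_of_ne x τ c₀ hqx]; exact hq
          · show s(x, q) = s(p, q)
            rw [hxp]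
        · have hpx : p ≠ x := fun h => G.ne_of_adj hpq (by rw [h, hxq])
          have hadj : G.Adj x p := by rw [hxq]; exact hpq.symm
          refine ⟨⟨p, Set.mem_compl_singleton_iff.mpr hpx⟩, ?_, ?_⟩
          · simp only [mem_filter, mem_univ, true_and]
            refine ⟨hadj, ?_⟩
            rw [← extCol_of_ne x τ c₀ hpx]; exact hp
          · show s(x, p) = s(p, q)
            rw [hxq, Sym2.eq_swap]
  · rw [card_eq_zero, filter_eq_empty_iff]
    intro e he hxe
    induction e using Sym2.ind with
    | _ p q =>
      rw [mk_mem_monoCol_iff] at he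
      obtain ⟨_, hp, hq⟩ := he
      rcases Sym2.mem_iff.1 hxe with hxp | hxq
      · rw [← hxp, extCol_self] at hp; exact hc hp
      · rw [← hxq, extCol_self] at hq; exact hc hq

/-- **COLOUR COUNTS SPLIT AT `x`**: `X_c(τ, x ↦ c₀) = X_c(τ) + [c₀ = c]·d_c(τ)`. [this work] -/
theorem cnt_extCol (τ : (({x}ᶜ : Set V)) → Fin 3) (c₀ c : Fin 3) :
    cnt G (extCol x τ c₀) c = cnt (G.induce ({x}ᶜ : Set V)) τ c + (if c₀ = c then prof G x τ c else 0) := by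
  have h1 := cnt_induce G ({x}ᶜ : Set V) (extCol x τ c₀) c
  rw [extCol_comp_val] at h1
  rw [h1, ← card_monoCol_extCol_filter_mem G x τ c₀ c]
  have h2 : ((monoCol G (extCol x τ c₀) c).filter fun e => x ∈ e)
      = (monoCol G (extCol x τ c₀) c).filter fun e => ¬Inside ({x}ᶜ : Set V) e :=
    filter_congr fun e _ => (not_inside_compl_iff x e).symm
  rw [h2]
  unfold cnt
  rw [card_filter_add_card_filter_not]

/-- `cap3` of a conditional count. [this work] -/
theorem cap3_ite (p : Prop) [Decidable p] (n : ℕ) : cap3 (if p then n else 0) = if p then cap3 n else 0 := by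
  split_ifs <;> rfl

/-- The part of the type carried by `x`: the profile coordinate of the colour of `x`, zero elsewhere. [this work] -/
def xPart (c₀ : Fin 3) (d : CType) : CType :=
  (if c₀ = 0 then d.1 else 0, if c₀ = 1 then d.2.1 else 0, if c₀ = 2 then d.2.2 else 0)

/-- **TYPE DECOMPOSITION AT `x`**: the capped type of `(τ, x ↦ c₀)` is the capped sum of the type of `τ` in `G − x` and the part
carried by `x`. [this work] -/
theorem ctype_extCol (τ : (({x}ᶜ : Set V)) → Fin 3) (c₀ : Fin 3) :
    ctype G (extCol x τ c₀) = ctAdd (ctype (G.induce ({x}ᶜ : Set V)) τ) (xPart c₀ (prof3 G x τ)) := by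
  unfold ctype ctAdd xPart prof3
  simp only [cnt_extCol, cap3_add, cap3_ite]

/-! ## The abstract kernel and its pointwise behaviour (finite checks) -/

/-- The ONE-POINT KERNEL as a function of the type `t` of `τ` in `G − x` and the capped profile `d` of `N(x)`:
`Σ_c lbW (t ⊕ d_c e_c) − lbW t`. [this work] -/
def kerAbs (t d : CType) : ℤ :=
  lbW (ctAdd t (xPart 0 d)) + lbW (ctAdd t (xPart 1 d)) + lbW (ctAdd t (xPart 2 d)) - lbW t

/-- **`K(τ) = kerAbs (type τ) (profile τ)`**. [this work] -/
theorem kerMZ_eq_kerAbs (τ : (({x}ᶜ : Set V)) → Fin 3) :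
    kerMZ G x τ = kerAbs (ctype (G.induce ({x}ᶜ : Set V)) τ) (prof3 G x τ) := by
  unfold kerMZ kerAbs
  rw [Fin.sum_univ_three, ← lbW_ctype, ← lbW_ctype, ← lbW_ctype, ← lbW_ctype, ctype_extCol, ctype_extCol, ctype_extCol]

/-- NO ABSENT COLOUR ⇒ `K ≥ 0` POINTWISE: if every colour occurs on `N(x)`, the kernel is nonnegative at every type. [this work] -/
theorem kerAbs_nonneg_of_ne_zero : ∀ t d : CType, d.1 ≠ 0 → d.2.1 ≠ 0 → d.2.2 ≠ 0 → 0 ≤ kerAbs t d := by decide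

/-- TWO SATURATED COLOURS ⇒ `K ≥ 0` POINTWISE (the boundary classes `(≥2, ≥2, ·)`). [this work] -/
theorem kerAbs_nonneg_of_two_two : ∀ t d : CType,
    (d.1 = 2 ∧ d.2.1 = 2) ∨ (d.1 = 2 ∧ d.2.2 = 2) ∨ (d.2.1 = 2 ∧ d.2.2 = 2) → 0 ≤ kerAbs t d := by decide

/-- Hence a negative kernel value forces an ABSENT colour on the boundary. [this work] -/
theorem exists_eq_zero_of_kerAbs_neg : ∀ t d : CType, kerAbs t d < 0 → d.1 = 0 ∨ d.2.1 = 0 ∨ d.2.2 = 0 := by decide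

/-- CONSTANT SATURATED BOUNDARY `d = (≥2, 0, 0)`: `K = lbW (t ∨ 2e_0) + lbW t` — the Lemma-B weights of the contracted graph
`(G−x)/N(x)` with a double mark and without (memo §1, class (≥2,0,0)). [this work] -/
theorem kerAbs_const_two : ∀ t : CType, kerAbs t (2, 0, 0) = lbW (ctAdd t (2, 0, 0)) + lbW t := by decide

/-- CONSTANT SINGLE BOUNDARY `d = (1, 0, 0)` (pendant `x`): `K = lbW (t + e_0) + lbW t` (a single mark and none). [this work] -/
theorem kerAbs_const_one : ∀ t : CType, kerAbs t (1, 0, 0) = lbW (ctAdd t (1, 0, 0)) + lbW t := by decide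

/-- The TWO-TERMINAL WEIGHT `fC t = lbW (t + e_0) + lbW (t + e_1)` of the memo's inequality (C) (terminal colours `0`, `1`):
`+1` on `e_0, e_1`, `+2` on `2e_0, 2e_1`, `−2` on `e_2`, `−1` on `e_0 + e_2, e_1 + e_2`, `0` elsewhere (`fC_table`). [this work] -/
def fC (t : CType) : ℤ := lbW (ctAdd t (1, 0, 0)) + lbW (ctAdd t (0, 1, 0))

/-- The value table of `fC`. [this work] -/
theorem fC_table : ∀ t : CType, fC t =
    (if t = (1, 0, 0) ∨ t = (0, 1, 0) then 1 else 0) + (if t = (2, 0, 0) ∨ t = (0, 2, 0) then 2 else 0)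
      - (if t = (0, 0, 1) then 2 else 0) - (if t = (1, 0, 1) ∨ t = (0, 1, 1) then 1 else 0) := by decide

/-- TWO-COLOURED BOUNDARY `d = (1, 1, 0)` (a degree-2 `x` with differently coloured neighbours): the kernel IS the two-terminal weight. [this work] -/
theorem kerAbs_one_one : ∀ t : CType, kerAbs t (1, 1, 0) = fC t := by decide

/-- TWO-COLOURED BOUNDARY `d = (≥2, 1, 0)`: the kernel is `lbW (t ∨ 2e_0) + lbW (t + e_1)` … [this work] -/
theorem kerAbs_two_one : ∀ t : CType, kerAbs t (2, 1, 0) = lbW (ctAdd t (2, 0, 0)) + lbW (ctAdd t (0, 1, 0)) := by decide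

/-- … and DOMINATES the two-terminal weight pointwise (so inequality (B) of the memo follows from (C)). [this work] -/
theorem fC_le_kerAbs_two_one : ∀ t : CType, fC t ≤ kerAbs t (2, 1, 0) := by decide

end OnePoint

/-- **THE PINNED OBLIGATION IMPLIES THE CONNECTED ONE-POINT OBLIGATION** `MZQConnected` of `…KempeConnected`. [this work] -/
theorem mzqConnected_of_pinnedMZ (h : PinnedMZ) : MZQConnected := by
  intro V _ G x hG hx
  have h1 := sum_kerMZ_nonneg_of_classes G x (h V G x hG hx)
  rw [← Qcol_sub_Qcol_induce] at h1
  linarith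

/-- **…HENCE LEMMA B FOR EVERY FINITE GRAPH** (via `Qcol_nonneg_of_MZQConnected'` of `…KempeUnion`, which absorbs disconnected graphs by
THEOREM A). [this work] -/
theorem Qcol_nonneg_of_pinnedMZ (h : PinnedMZ) {W : Type} [Fintype W] (H : SimpleGraph W) : 0 ≤ Qcol H :=
  Qcol_nonneg_of_MZQConnected' (mzqConnected_of_pinnedMZ h) H

end Summit.CriticalPhenomena.PercolationContinuityZ3.Theorems.SunflowerPartition.Kempe
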